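import Literature.IUT.LogVolume.LocalFieldVolume
import Literature.IUT.LogVolume.ArchimedeanVolume

/-!
# Degenerate (junk) values of the genuine local log-volumes: null and infinite-measure sets

[AbsTopIII] (S. Mochizuki, *Topics in Absolute Anabelian Geometry III*, J. Math. Sci. Univ. Tokyo 22
(2015)), Prop. 5.7 (i) p. 137 defines the log-volume `μ^log_k` only on `M(k)`, "the set of compact open
subsets of `k`" — sets of positive finite Haar measure — and Prop. 5.7 (ii) p. 138 (archimedean `k`) only
on compact sets whose radial projection "is the closure of its interior".  The tree's genuine
log-volumes `localLogVolume K A = log μ_K(A)` (`LocalFieldVolume.lean`) and `radialLogVolume A`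
(`ArchimedeanVolume.lean`) are TOTAL functions on `Set K` / `Set ℂ`; outside print's domain they return
the junk value `Real.log 0 = 0`, which COINCIDES with the normalisation `μ^log_k(O_k) = 0`.  This
proof-only file records those junk values as kernel theorems, so that every consumer (admissibility
predicates of the [IUTchIII] Cor. 3.12 containers, hull / region bookkeeping) can see that a region must
be of positive finite measure before its log-volume carries information:
* `localLogVolume_of_localVolume_eq_zero`, `localLogVolume_empty`, `localLogVolume_singleton`,
  `localLogVolume_of_countable` — null sets have log-volume `0 = μ^log(O_K)`;
* `localLogVolume_of_localVolume_eq_top`, `localLogVolume_univ` — so do sets of infinite measure;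
* `radialLogVolume_of_radialVolume_eq_zero`, `radialLogVolume_sphere` — the archimedean twin: a circle
  projects radially to a point, so its radial log-volume is `0 = μ^log(O_k)`.
No definition, no named fact; classical measure theory; takes no side on [IUTchIII] Cor. 3.12.
[cite: MochizukiAbsTopIII2015, Prop. 5.7 (i) p. 137] [cite: MochizukiAbsTopIII2015, Prop. 5.7 (ii) p. 138]
-/

noncomputable section

open MeasureTheory Set Metric

namespace Literature.IUT.LogVolume

section Nonarchimedean

variable (K : Type*) [NontriviallyNormedField K] [IsUltrametricDist K] [ProperSpace K]
  [MeasurableSpace K] [BorelSpace K]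

/-- A Haar-NULL set has log-volume `0` — the junk value of `Real.log` at `0`, equal to `μ^log(O_K)`;
print's `M(k)` (compact OPEN sets) excludes such sets. [cite: MochizukiAbsTopIII2015, Prop. 5.7 (i) p. 137] -/
theorem localLogVolume_of_localVolume_eq_zero {A : Set K} (hA : localVolume K A = 0) :
    localLogVolume K A = 0 := by
  rw [localLogVolume_eq_log, hA, ENNReal.toReal_zero, Real.log_zero]

/-- The log-volume of the empty set is the junk value `0 = μ^log(O_K)`.
[cite: MochizukiAbsTopIII2015, Prop. 5.7 (i) p. 137] -/
@[simp] theorem localLogVolume_empty : localLogVolume K (∅ : Set K) = 0 :=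
  localLogVolume_of_localVolume_eq_zero K (measure_empty (μ := localVolume K))

/-- The log-volume of a point is the junk value `0 = μ^log(O_K)` (Haar measure on a nontrivially
normed field has no atoms). [cite: MochizukiAbsTopIII2015, Prop. 5.7 (i) p. 137] -/
@[simp] theorem localLogVolume_singleton (x : K) : localLogVolume K ({x} : Set K) = 0 :=
  localLogVolume_of_localVolume_eq_zero K (measure_singleton x)

/-- Every countable set has the junk log-volume `0`. [cite: MochizukiAbsTopIII2015, Prop. 5.7 (i) p. 137] -/
theorem localLogVolume_of_countable {A : Set K} (hA : A.Countable) : localLogVolume K A = 0 :=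
  localLogVolume_of_localVolume_eq_zero K (hA.measure_zero (localVolume K))

/-- A set of INFINITE Haar measure also has log-volume `0` (`ENNReal.toReal ⊤ = 0`); print's `M(k)`
(COMPACT open sets) excludes such sets. [cite: MochizukiAbsTopIII2015, Prop. 5.7 (i) p. 137] -/
theorem localLogVolume_of_localVolume_eq_top {A : Set K} (hA : localVolume K A = ⊤) :
    localLogVolume K A = 0 := by
  rw [localLogVolume_eq_log, hA, ENNReal.toReal_top, Real.log_zero]

/-- In particular the whole (noncompact) field has log-volume `0 = μ^log(O_K)`.
[cite: MochizukiAbsTopIII2015, Prop. 5.7 (i) p. 137] -/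
theorem localLogVolume_univ : localLogVolume K (univ : Set K) = 0 :=
  localLogVolume_of_localVolume_eq_top K (measure_univ_of_isAddLeftInvariant (localVolume K))

end Nonarchimedean

section Archimedean

/-- Archimedean twin: a set whose radial projection is Lebesgue-null has radial log-volume `0 = μ^log(O_k)`;
print's `M(k)` requires the projection to be the closure of its interior.
[cite: MochizukiAbsTopIII2015, Prop. 5.7 (ii) p. 138] -/
theorem radialLogVolume_of_radialVolume_eq_zero {A : Set ℂ} (hA : radialVolume A = 0) :
    radialLogVolume A = 0 := by
  rw [radialLogVolume, hA, ENNReal.toReal_zero, Real.log_zero]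

/-- The circle of radius `r` projects radially to the point `{r}`, so its radial log-volume is the junk
value `0` — for `r = 1` this is `O_k^× = S¹`, whose radial log-volume thus equals `μ^log(O_k) = 0`.
[cite: MochizukiAbsTopIII2015, Prop. 5.7 (ii) p. 138] -/
theorem radialLogVolume_sphere (r : ℝ) : radialLogVolume (sphere (0 : ℂ) r) = 0 := by
  refine radialLogVolume_of_radialVolume_eq_zero (measure_mono_null (t := {r}) ?_ (by simp))
  rintro _ ⟨z, hz, rfl⟩
  simpa [radialProj] using hz

end Archimedean

end Literature.IUT.LogVolume

end
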